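import Literature.Geometry.Lorentzian.KerrSchildDivergence
import HarnessLib

/-!
# Axial symmetry of the Kerr–Schild chart: the rotations about the `z`-axis, invariance of
# `r`, `Σ`, `H`, equivariance of `ℓ♯`, of the inverse metric and of its divergence

(family `gr`; namespace `Literature.Geometry.Lorentzian.E4` for the rotation of the coordinate space,
`Literature.Geometry.Lorentzian.Kerr` for the Kerr-specific statements)

The axial Killing field of the Kerr chart is `∂_φ = x₁ ∂₂ − x₂ ∂₁` (`Kerr.axialField`); its flow is
the one-parameter group of rotations of the `(x₁, x₂)`-plane,
`R_α (t*, x₁, x₂, x₃) = (t*, x₁ cos α − x₂ sin α, x₁ sin α + x₂ cos α, x₃)`. This file provides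

* `E4.axialRotation α : E4 →L[ℝ] E4` with its group law (`axialRotation_zero_apply`,
  `axialRotation_add_apply`, `axialRotation_neg_axialRotation`), the invariance of the spatial radius
  `‖x⃗‖`, of `t*` and `z`, and of the flat metric `η` on symmetric traces
  (`sum_etaComp_bilin_axialRotation`);
* on the Kerr side: invariance of the Kerr–Schild radius `r` (`Kerr.radius_axialRotation`), of
  `Σ` and of `H` (`Kerr.blSigma_axialRotation`, `Kerr.scalarH_axialRotation`), membership in the
  charts `Kerr.region a r₀` (`Kerr.axialRotate`, a self-map of the chart), **equivariance of the
  null vector** `ℓ♯(R_α x) = R_α ℓ♯(x)` (`Kerr.nullVector_axialRotation`), and consequently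
  **equivariance of the inverse metric** contracted with any bilinear form,
  `∑ g^{μν}(R_α x) B(∂_μ, ∂_ν) = ∑ g^{μν}(x) B(R_α∂_μ, R_α∂_ν)` (`Kerr.sum_inverseMetric_axialRotation`),
  and of its divergence, `c(R_α x) = R_α c(x)` for `c^ν = ∑_μ ∂_μ g^{μν} = −(2M/Σ)ℓ^ν`
  (`Kerr.sum_divInverseMetric_axialRotation`, from `Kerr.divInverseMetric_eq`).

Together with the coordinate formula for `□_g` these give the equivariance of the wave operator under
the axial rotations, `□_g(ψ ∘ R_α) = (□_g ψ) ∘ R_α`, used for the projection of solutions to their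
axisymmetric part (Aretakis, ATMP 19 (2015), Thm. 3: "projecting to the zeroth azimuthal
frequency"); that statement involves the prelude's `dalembertian` and is proved where it is used
(`Literature/Barriers/FinalStateConjecture/`).

## References

* B. O'Neill, *The geometry of Kerr black holes*, 1995, Ch. 2, §2.2 (the Killing fields `∂_t`,
  `∂_φ`; axial symmetry) (key `ONeill1995`).
* R. P. Kerr, A. Schild, 1965, §2 (key `KerrSchild1965`); M. Visser, arXiv:0706.0622, (32)–(35)
  (key `arXiv07060622`).
-/

noncomputable section

open Set

namespace Literature.Geometry.Lorentzian

namespace E4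

/-- The underlying linear map of the axial rotation by the angle `α`. [folklore] -/
def axialRotationLin (α : ℝ) : E4 →ₗ[ℝ] E4 where
  toFun x := WithLp.toLp 2 ![x 0, Real.cos α * x 1 - Real.sin α * x 2,
    Real.sin α * x 1 + Real.cos α * x 2, x 3]
  map_add' x y := by
    ext i
    fin_cases i <;> simp <;> ring
  map_smul' c x := by
    ext i
    fin_cases i <;> simp <;> ring

/-- **The axial rotation** `R_α (t*, x₁, x₂, x₃) = (t*, x₁ cos α − x₂ sin α, x₁ sin α + x₂ cos α, x₃)`
of the Kerr–Schild coordinate space, the time-`α` flow map of the axial Killing field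
`∂_φ = x₁ ∂₂ − x₂ ∂₁` (`Kerr.axialField`), as a continuous linear map. O'Neill 1995, Ch. 2, §2.2.
[cite: ONeill1995, Ch. 2 §2.2] -/
def axialRotation (α : ℝ) : E4 →L[ℝ] E4 :=
  LinearMap.toContinuousLinearMap (axialRotationLin α)

/-- `t*` is invariant. [folklore] -/
@[simp] theorem axialRotation_apply_zero (α : ℝ) (x : E4) : axialRotation α x 0 = x 0 := by
  simp [axialRotation, axialRotationLin]

/-- The rotated `x₁`. [folklore] -/
@[simp] theorem axialRotation_apply_one (α : ℝ) (x : E4) :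
    axialRotation α x 1 = Real.cos α * x 1 - Real.sin α * x 2 := by
  simp [axialRotation, axialRotationLin]

/-- The rotated `x₂`. [folklore] -/
@[simp] theorem axialRotation_apply_two (α : ℝ) (x : E4) :
    axialRotation α x 2 = Real.sin α * x 1 + Real.cos α * x 2 := by
  simp [axialRotation, axialRotationLin]

/-- `z = x₃` is invariant. [folklore] -/
@[simp] theorem axialRotation_apply_three (α : ℝ) (x : E4) : axialRotation α x 3 = x 3 := by
  simp [axialRotation, axialRotationLin]

/-- `R₀ = id`. [folklore] -/
@[simp] theorem axialRotation_zero_apply (x : E4) : axialRotation 0 x = x := by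
  ext i
  fin_cases i <;> simp

/-- Group law `R_{α+β} = R_α ∘ R_β`. [folklore] -/
theorem axialRotation_add_apply (α β : ℝ) (x : E4) :
    axialRotation (α + β) x = axialRotation α (axialRotation β x) := by
  ext i
  fin_cases i
  · simp
  · simp [Real.cos_add, Real.sin_add]; ring
  · simp [Real.cos_add, Real.sin_add]; ring
  · simp

/-- `R_{−α} ∘ R_α = id`. [folklore] -/
@[simp] theorem axialRotation_neg_axialRotation (α : ℝ) (x : E4) :
    axialRotation (-α) (axialRotation α x) = x := by
  rw [← axialRotation_add_apply, neg_add_cancel, axialRotation_zero_apply]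

/-- `R_α ∘ R_{−α} = id`. [folklore] -/
@[simp] theorem axialRotation_axialRotation_neg (α : ℝ) (x : E4) :
    axialRotation α (axialRotation (-α) x) = x := by
  rw [← axialRotation_add_apply, add_neg_cancel, axialRotation_zero_apply]

/-- The rotation is bijective (a self-inverse family). [folklore] -/
theorem axialRotation_bijective (α : ℝ) : Function.Bijective (axialRotation α) :=
  ⟨fun x y h ↦ by simpa using congrArg (axialRotation (-α)) h,
    fun y ↦ ⟨axialRotation (-α) y, axialRotation_axialRotation_neg α y⟩⟩

/-- **The spatial radius is invariant**: `‖(R_α x)⃗‖ = ‖x⃗‖`. [folklore] -/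
theorem spatialNorm_axialRotation (α : ℝ) (x : E4) : spatialNorm (axialRotation α x) = spatialNorm x := by
  have h1 : spatialNorm (axialRotation α x) ^ 2 = spatialNorm x ^ 2 := by
    rw [spatialNorm_sq, spatialNorm_sq, axialRotation_apply_one, axialRotation_apply_two,
      axialRotation_apply_three]
    have h := Real.sin_sq_add_cos_sq α
    linear_combination (x 1 ^ 2 + x 2 ^ 2) * h
  nlinarith [spatialNorm_nonneg (axialRotation α x), spatialNorm_nonneg x, h1]

/-- The rotation fixes the time axis: `R_α ∂_{t*} = ∂_{t*}`. [folklore] -/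
@[simp] theorem axialRotation_basisVector_zero (α : ℝ) :
    axialRotation α (basisVector 0) = basisVector 0 := by
  ext i
  fin_cases i <;> simp

/-- The rotation fixes the `z`-axis: `R_α ∂₃ = ∂₃`. [folklore] -/
@[simp] theorem axialRotation_basisVector_three (α : ℝ) :
    axialRotation α (basisVector 3) = basisVector 3 := by
  ext i
  fin_cases i <;> simp

/-- The rotation commutes with `t*`-translations. [folklore] -/
theorem axialRotation_add_smul_basisVector_zero (α : ℝ) (x : E4) (s : ℝ) :
    axialRotation α (x + s • basisVector 0) = axialRotation α x + s • basisVector 0 := by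
  rw [map_add, map_smul, axialRotation_basisVector_zero]

/-- The Minkowski components `η_{μν} = diag(−1,1,1,1)` (a copy of `Kerr.etaComp` avoiding the import
direction). [cite: ONeill1983, Ch. 3, p. 55] -/
theorem sum_etaComp_bilin_axialRotation (α : ℝ) (B : E4 →L[ℝ] E4 →L[ℝ] ℝ) :
    ∑ μ, ∑ ν, Kerr.etaComp μ ν * B (axialRotation α (basisVector μ)) (axialRotation α (basisVector ν)) =
      ∑ μ, ∑ ν, Kerr.etaComp μ ν * B (basisVector μ) (basisVector ν) := by
  -- expand the rotated basis vectors in the basis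
  have h1 : axialRotation α (basisVector 1) = Real.cos α • basisVector 1 + Real.sin α • basisVector 2 := by
    ext i; fin_cases i <;> simp
  have h2 : axialRotation α (basisVector 2) =
      (-Real.sin α) • basisVector 1 + Real.cos α • basisVector 2 := by
    ext i; fin_cases i <;> simp
  simp only [Fin.sum_univ_four, Kerr.etaComp, Fin.isValue, Fin.reduceEq, ↓reduceIte,
    axialRotation_basisVector_zero, axialRotation_basisVector_three, h1, h2, map_add, map_smul,
    FunLike.coe_add, Pi.add_apply, FunLike.coe_smul, Pi.smul_apply, smul_eq_mul]
  have h := Real.sin_sq_add_cos_sq α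
  linear_combination (B (basisVector 1) (basisVector 1) + B (basisVector 2) (basisVector 2)) * h

/-- The full Euclidean norm of `E4` is invariant too (used for compactness arguments). [folklore] -/
theorem norm_axialRotation (α : ℝ) (x : E4) : ‖axialRotation α x‖ = ‖x‖ := by
  have h1 : ‖axialRotation α x‖ ^ 2 = ‖x‖ ^ 2 := by
    rw [EuclideanSpace.real_norm_sq_eq, EuclideanSpace.real_norm_sq_eq, Fin.sum_univ_four,
      Fin.sum_univ_four, axialRotation_apply_zero, axialRotation_apply_one, axialRotation_apply_two,
      axialRotation_apply_three]
    have h := Real.sin_sq_add_cos_sq α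
    linear_combination (x 1 ^ 2 + x 2 ^ 2) * h
  nlinarith [norm_nonneg (axialRotation α x), norm_nonneg x, h1]

/-- **Joint smoothness of the flow** `(α, x) ↦ R_α x` (entries `cos α`, `sin α` times coordinates).
[folklore] -/
theorem contDiff_axialRotation_uncurry {n : WithTop ℕ∞} :
    ContDiff ℝ n fun q : ℝ × E4 ↦ axialRotation q.1 q.2 := by
  rw [contDiff_euclidean]
  have hc : ∀ j : Fin 4, ContDiff ℝ n fun q : ℝ × E4 ↦ q.2 j := fun j ↦
    (contDiff_euclidean.mp contDiff_snd) j
  have hcos : ContDiff ℝ n fun q : ℝ × E4 ↦ Real.cos q.1 := Real.contDiff_cos.comp contDiff_fst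
  have hsin : ContDiff ℝ n fun q : ℝ × E4 ↦ Real.sin q.1 := Real.contDiff_sin.comp contDiff_fst
  intro i
  fin_cases i
  · simpa using hc 0
  · have h : ContDiff ℝ n fun q : ℝ × E4 ↦ Real.cos q.1 * q.2 1 - Real.sin q.1 * q.2 2 :=
      (hcos.mul (hc 1)).sub (hsin.mul (hc 2))
    simpa using h
  · have h : ContDiff ℝ n fun q : ℝ × E4 ↦ Real.sin q.1 * q.2 1 + Real.cos q.1 * q.2 2 :=
      (hsin.mul (hc 1)).add (hcos.mul (hc 2))
    simpa using h
  · simpa using hc 3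

/-- The flow is jointly continuous. [folklore] -/
theorem continuous_axialRotation_uncurry : Continuous fun q : ℝ × E4 ↦ axialRotation q.1 q.2 :=
  (contDiff_axialRotation_uncurry (n := 0)).continuous

end E4

namespace Kerr

/-! ### Invariance of the Kerr–Schild scalars and equivariance of `ℓ♯` -/

/-- **The Kerr–Schild radius is axisymmetric**: `r(R_α x) = r(x)` (it depends on `‖x⃗‖` and `z`
only). Kerr–Schild 1965, §2; Visser arXiv:0706.0622, (35). [cite: arXiv07060622, (35)] -/
theorem radius_axialRotation (a α : ℝ) (x : E4) : radius a (E4.axialRotation α x) = radius a x := by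
  unfold radius
  rw [E4.spatialNorm_axialRotation, E4.axialRotation_apply_three]

/-- Membership in the chart is invariant under the rotations. [folklore] -/
theorem axialRotation_mem_region_iff {a r₀ α : ℝ} {x : E4} :
    E4.axialRotation α x ∈ region a r₀ ↔ x ∈ region a r₀ := by
  rw [mem_region, mem_region, radius_axialRotation]

/-- **The axial rotation of the chart** `Kerr.region a r₀`, `x ↦ R_α x` (the flow of the axial
Killing field `∂_φ`, `Kerr.axialField`, restricted to the chart, which it preserves). O'Neill 1995,
Ch. 2, §2.2. [cite: ONeill1995, Ch. 2 §2.2] -/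
def axialRotate (a r₀ α : ℝ) (x : region a r₀) : region a r₀ :=
  ⟨E4.axialRotation α x, axialRotation_mem_region_iff.mpr x.2⟩

/-- The rotated point in coordinates. [folklore] -/
@[simp] theorem coe_axialRotate (a r₀ α : ℝ) (x : region a r₀) :
    (axialRotate a r₀ α x : E4) = E4.axialRotation α x := rfl

/-- `R₀ = id` on the chart. [folklore] -/
@[simp] theorem axialRotate_zero (a r₀ : ℝ) (x : region a r₀) : axialRotate a r₀ 0 x = x := by
  ext1
  simp

/-- Group law on the chart. [folklore] -/
theorem axialRotate_add (a r₀ α β : ℝ) (x : region a r₀) :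
    axialRotate a r₀ (α + β) x = axialRotate a r₀ α (axialRotate a r₀ β x) := by
  ext1
  simp [E4.axialRotation_add_apply]

/-- `R_{−α} ∘ R_α = id` on the chart. [folklore] -/
@[simp] theorem axialRotate_neg_axialRotate (a r₀ α : ℝ) (x : region a r₀) :
    axialRotate a r₀ (-α) (axialRotate a r₀ α x) = x := by
  ext1
  simp

/-- `R_α ∘ R_{−α} = id` on the chart. [folklore] -/
@[simp] theorem axialRotate_axialRotate_neg (a r₀ α : ℝ) (x : region a r₀) :
    axialRotate a r₀ α (axialRotate a r₀ (-α) x) = x := by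
  ext1
  simp

/-- The chart rotation is continuous. [folklore] -/
theorem continuous_axialRotate (a r₀ α : ℝ) : Continuous (axialRotate a r₀ α) :=
  Continuous.subtype_mk ((E4.axialRotation α).continuous.comp continuous_subtype_val) _

/-- The chart rotation is jointly continuous in the angle and the point. [folklore] -/
theorem continuous_axialRotate_uncurry (a r₀ : ℝ) :
    Continuous fun q : ℝ × region a r₀ ↦ axialRotate a r₀ q.1 q.2 := by
  refine Continuous.subtype_mk ?_ _
  show Continuous fun q : ℝ × region a r₀ ↦ E4.axialRotation q.1 (q.2 : E4)
  have h : ∀ q : ℝ × region a r₀, E4.axialRotation q.1 (q.2 : E4) = WithLp.toLp 2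
      ![(q.2 : E4) 0, Real.cos q.1 * (q.2 : E4) 1 - Real.sin q.1 * (q.2 : E4) 2,
        Real.sin q.1 * (q.2 : E4) 1 + Real.cos q.1 * (q.2 : E4) 2, (q.2 : E4) 3] := fun q ↦ rfl
  simp only [h]
  refine (PiLp.continuous_toLp 2 _).comp (continuous_pi fun i ↦ ?_)
  have hc : ∀ j : Fin 4, Continuous fun q : ℝ × region a r₀ ↦ (q.2 : E4) j := fun j ↦
    (PiLp.continuous_apply 2 _ j).comp (continuous_subtype_val.comp continuous_snd)
  fin_cases i
  · simpa using hc 0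
  · have h : Continuous fun q : ℝ × region a r₀ ↦
        Real.cos q.1 * (q.2 : E4) 1 - Real.sin q.1 * (q.2 : E4) 2 :=
      ((Real.continuous_cos.comp continuous_fst).mul (hc 1)).sub
        ((Real.continuous_sin.comp continuous_fst).mul (hc 2))
    simpa using h
  · have h : Continuous fun q : ℝ × region a r₀ ↦
        Real.sin q.1 * (q.2 : E4) 1 + Real.cos q.1 * (q.2 : E4) 2 :=
      ((Real.continuous_sin.comp continuous_fst).mul (hc 1)).add
        ((Real.continuous_cos.comp continuous_fst).mul (hc 2))
    simpa using h
  · simpa using hc 3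

/-- `Σ` is axisymmetric. [folklore] -/
theorem blSigma_axialRotation (a α : ℝ) (x : E4) :
    blSigma a (E4.spatial (E4.axialRotation α x)) = blSigma a (E4.spatial x) := by
  rw [blSigma_spatial_eq, blSigma_spatial_eq, radius_axialRotation, E4.spatialNorm_axialRotation]

/-- **`H` is axisymmetric**: `H(R_α x) = H(x)`. Kerr–Schild 1965, §2. [cite: KerrSchild1965, §2] -/
theorem scalarH_axialRotation (M a α : ℝ) (x : E4) :
    scalarH M a (E4.axialRotation α x) = scalarH M a x := by
  unfold scalarH
  rw [radius_axialRotation, E4.axialRotation_apply_three]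

/-- **The null vector is equivariant**: `ℓ♯(R_α x) = R_α ℓ♯(x)` — the spatial part
`((r x + a y), (r y − a x))/(r² + a²)` rotates with `(x, y)`, the `z`- and `t*`-components are
invariant. Kerr–Schild 1965, §2 (axial symmetry of the congruence). [cite: KerrSchild1965, §2] -/
theorem nullVector_axialRotation (a α : ℝ) (x : E4) :
    nullVector a (E4.axialRotation α x) = E4.axialRotation α (nullVector a x) := by
  have hr := radius_axialRotation a α x
  ext i
  fin_cases i
  · simp
  · show nullVector a (E4.axialRotation α x) 1 = E4.axialRotation α (nullVector a x) 1
    rw [nullVector_apply_one, nullCovectorFun_apply_one, hr, E4.axialRotation_apply_one,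
      E4.axialRotation_apply_one, E4.axialRotation_apply_two, nullVector_apply_one,
      nullVector_apply_two, nullCovectorFun_apply_one, nullCovectorFun_apply_two]
    have hQ : radius a x ^ 2 + a ^ 2 ≠ 0 ∨ radius a x ^ 2 + a ^ 2 = 0 := ne_or_eq _ _
    rcases hQ with hQ | hQ
    · field_simp
      ring
    · simp [hQ]
  · show nullVector a (E4.axialRotation α x) 2 = E4.axialRotation α (nullVector a x) 2
    rw [nullVector_apply_two, nullCovectorFun_apply_two, hr, E4.axialRotation_apply_one,
      E4.axialRotation_apply_two, E4.axialRotation_apply_two, nullVector_apply_one,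
      nullVector_apply_two, nullCovectorFun_apply_one, nullCovectorFun_apply_two]
    have hQ : radius a x ^ 2 + a ^ 2 ≠ 0 ∨ radius a x ^ 2 + a ^ 2 = 0 := ne_or_eq _ _
    rcases hQ with hQ | hQ
    · field_simp
      ring
    · simp [hQ]
  · show nullVector a (E4.axialRotation α x) 3 = E4.axialRotation α (nullVector a x) 3
    rw [nullVector_apply_three, nullCovectorFun_apply_three, hr, E4.axialRotation_apply_three,
      E4.axialRotation_apply_three, nullVector_apply_three, nullCovectorFun_apply_three]

/-! ### Equivariance of the inverse metric and of its divergence -/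

/-- Contraction of `ℓ♯ ⊗ ℓ♯` with a bilinear form: `∑ ℓ^μ ℓ^ν B(∂_μ, ∂_ν) = B(ℓ♯, ℓ♯)`… in the
general form `∑ u^μ v^ν B(∂_μ,∂_ν) = B(u, v)`. [folklore] -/
theorem sum_sum_mul_bilin_basisVector (B : E4 →L[ℝ] E4 →L[ℝ] ℝ) (u v : E4) :
    ∑ μ, ∑ ν, u μ * v ν * B (E4.basisVector μ) (E4.basisVector ν) = B u v := by
  conv_rhs => rw [eq_sum_basisVector u, map_sum, FunLike.coe_sum, Finset.sum_apply]
  refine Finset.sum_congr rfl fun μ _ ↦ ?_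
  conv_rhs => rw [map_smul, FunLike.coe_smul, Pi.smul_apply, smul_eq_mul, eq_sum_basisVector v,
    map_sum, Finset.mul_sum]
  refine Finset.sum_congr rfl fun ν _ ↦ ?_
  rw [map_smul, smul_eq_mul]
  ring

/-- **Equivariance of the inverse Kerr metric under the axial rotations**, contracted with an
arbitrary bilinear form `B`: `∑ g^{μν}(R_α x) B(∂_μ, ∂_ν) = ∑ g^{μν}(x) B(R_α ∂_μ, R_α ∂_ν)`, i.e.
`g⁻¹(R_α x) = R_α g⁻¹(x) R_αᵀ` (from `g^{μν} = η^{μν} − 2H ℓ^μ ℓ^ν`, `η`-invariance of `R_α`,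
`H(R_α x) = H(x)` and `ℓ♯(R_α x) = R_α ℓ♯(x)`). O'Neill 1995, Ch. 2, §2.2 (`∂_φ` is Killing).
[cite: ONeill1995, Ch. 2 §2.2] -/
theorem sum_inverseMetric_axialRotation (M a α : ℝ) (x : E4) (B : E4 →L[ℝ] E4 →L[ℝ] ℝ) :
    ∑ μ, ∑ ν, inverseMetric M a (E4.axialRotation α x) μ ν * B (E4.basisVector μ) (E4.basisVector ν) =
      ∑ μ, ∑ ν, inverseMetric M a x μ ν *
        B (E4.axialRotation α (E4.basisVector μ)) (E4.axialRotation α (E4.basisVector ν)) := by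
  -- both sides are `tr_η − 2H B(Rℓ♯, Rℓ♯)`
  have hL : ∀ (y : E4) (C : E4 →L[ℝ] E4 →L[ℝ] ℝ),
      ∑ μ, ∑ ν, inverseMetric M a y μ ν * C (E4.basisVector μ) (E4.basisVector ν) =
        ∑ μ, ∑ ν, etaComp μ ν * C (E4.basisVector μ) (E4.basisVector ν) -
          2 * scalarH M a y * C (nullVector a y) (nullVector a y) := by
    intro y C
    have h1 : ∀ μ ν, inverseMetric M a y μ ν * C (E4.basisVector μ) (E4.basisVector ν) =
        etaComp μ ν * C (E4.basisVector μ) (E4.basisVector ν) -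
          2 * scalarH M a y * (nullVector a y μ * nullVector a y ν *
            C (E4.basisVector μ) (E4.basisVector ν)) := by
      intro μ ν; rw [inverseMetric_apply]; simp only [etaComp]; ring
    simp only [h1, Finset.sum_sub_distrib, ← Finset.mul_sum, sum_sum_mul_bilin_basisVector]
  -- the right-hand side is the contraction with the pulled-back form `C = B ∘ (R × R)`
  set C : E4 →L[ℝ] E4 →L[ℝ] ℝ := (B.comp (E4.axialRotation α)).flip.comp (E4.axialRotation α) |>.flip
    with hC
  have hCapp : ∀ u v, C u v = B (E4.axialRotation α u) (E4.axialRotation α v) := by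
    intro u v; simp [hC]
  have hRHS : ∑ μ, ∑ ν, inverseMetric M a x μ ν *
      B (E4.axialRotation α (E4.basisVector μ)) (E4.axialRotation α (E4.basisVector ν)) =
      ∑ μ, ∑ ν, inverseMetric M a x μ ν * C (E4.basisVector μ) (E4.basisVector ν) := by
    simp only [hCapp]
  rw [hRHS, hL, hL, scalarH_axialRotation, nullVector_axialRotation, hCapp]
  simp only [hCapp, E4.sum_etaComp_bilin_axialRotation]

/-- **Equivariance of the divergence of the inverse metric**: the vector `c = ∑ c^ν ∂_ν`,
`c^ν = ∑_μ ∂_μ g^{μν} = −(2M/Σ) ℓ^ν` (`divInverseMetric_eq`), satisfies `c(R_α x) = R_α c(x)`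
wherever `r > 0`. [cite: KerrSchild1965, §2] -/
theorem sum_divInverseMetric_axialRotation (M a α : ℝ) {x : E4} (hx : 0 < radius a x) :
    ∑ ν, divInverseMetric M a (E4.axialRotation α x) ν • E4.basisVector ν =
      E4.axialRotation α (∑ ν, divInverseMetric M a x ν • E4.basisVector ν) := by
  have hx' : 0 < radius a (E4.axialRotation α x) := by rwa [radius_axialRotation]
  have h1 : ∑ ν, divInverseMetric M a (E4.axialRotation α x) ν • E4.basisVector ν =
      (-(2 * M / blSigma a (E4.spatial (E4.axialRotation α x)))) • nullVector a (E4.axialRotation α x) := by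
    conv_rhs => rw [eq_sum_basisVector (nullVector a (E4.axialRotation α x)), Finset.smul_sum]
    refine Finset.sum_congr rfl fun ν _ ↦ ?_
    rw [divInverseMetric_eq M a hx', smul_smul]
  have h2 : ∑ ν, divInverseMetric M a x ν • E4.basisVector ν =
      (-(2 * M / blSigma a (E4.spatial x))) • nullVector a x := by
    conv_rhs => rw [eq_sum_basisVector (nullVector a x), Finset.smul_sum]
    refine Finset.sum_congr rfl fun ν _ ↦ ?_
    rw [divInverseMetric_eq M a hx, smul_smul]
  rw [h1, h2, map_smul, blSigma_axialRotation, nullVector_axialRotation]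

end Kerr

end Literature.Geometry.Lorentzian

end
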